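/-
Copyright (c) 2026 the pub-hodgecm-mathlib formalisation cell (harness21).  Prover seat hodgecm-mathlib-F0P3a-p08 (g18): «S3-ram» seeding wave (LEAD F0P3a-plan (g12)
T11-41; owner p06 (g15)), row «H2-int-ram» — unimodular hermitian lattices of RANK THREE over the valuation ring of a tamely ramified quadratic extension; 2026-09-01.
-/
import Literature.NumberTheory.QuadraticForms.HermitianUnimodularRankTwoDetClass   -- ★ A-p06 (g27): the rank-2 engine `exists_formCongr_eq_diagonal_one`, `exists_formCongr_eq_of_det_eq_mul_norm`, `det_formCongr`, `exists_add_map_eq_one`; brings ★ `HermitianUnimodular.exists_isUnit_formCongr_diag` and ★ `formCongr_mul_eq_formCongr_formCongr` ∕ `formCongr_hermitian`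
import HarnessLib

/-!
# Unimodular hermitian lattices of RANK THREE over a local ring with a RESIDUALLY TRIVIAL involution (the tamely RAMIFIED case): two such Gram matrices are
# congruent iff their determinants agree modulo norms; every one is congruent to `−det H · antidiag(1,1,1)` (Jacobowitz 1962, §8; O'Meara, §92)

Topic `NumberTheory/QuadraticForms`; namespace `Literature.NumberTheory.QuadraticForms.HermitianUnimodularRamified` (= ★ A-p06's rank-2 file, extended to rank 3).  KERNEL ONLY:
theorems, no definition, no instance, no notation, no named fact, no `sorry`; pure commutative algebra.  Cell `pub/hodgecm-mathlib` (D-0151), crux H413, «S3-ram» seeding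
wave (LEAD T11-41, owner p06 (g15)), row «H2-int-ram»: the ENGINE behind the INTEGRAL antidiagonal frame binder
`(A ∈ GL₃(𝒪_w)) (hframe : H′_w = (−det H′_w) • ᵗσ_w(A) J₀ A)` of the ramified fold (END F0P3a-p03 (g16), `LocalTransferAtOneTameRamified`, socket `stub_rankRam`; head
★ A-p19 p846850) — the ramified twin of ★ `HermitianUnimodular.exists_formCongr_eq` (which needs «every fixed unit is a norm», false at a ramified place).

SETTING (as in ★ `HermitianUnimodularRankTwoDetClass`).  `R` commutative LOCAL, `σ` an involution with (two) `2 ∈ R^×`, (res) `σ r − r ∈ 𝔪`, (norm₁) every `σ`-fixed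
unit `≡ 1 (mod 𝔪)` is a norm `t σ t`, FINITE residue field; `formCongr σ T H = (σT)ᵀ H T`.

THE MATHEMATICS [Jacobowitz1962, §8; Omeara1963, §92:1–2].  (§1) 3 × 3 bookkeeping: swaps, the Schur transvection splitting a unit pivot `H ≅ diag(u) ⊥ P`, the
block embedding `diag(1, T′)`.  (§2) **`exists_formCongr_eq_diagonal_one_three`**: every unimodular `σ`-hermitian `H ∈ M₃(R)` is congruent to `diag(1, u, δ)` with `u, δ`
fixed units (unit pivot ★ `HermitianUnimodular.exists_isUnit_formCongr_diag` — (trace) from (two) — moved to position `0`, Schur split, ★ rank-2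
`exists_formCongr_eq_diagonal_one` on the complement `P ≅ diag(1, δ)`, then the swap `0 ↔ 1`).  (§3) **`exists_formCongr_eq_of_det_eq_mul_norm_three`**: unimodular
hermitian `H₁, H₂ ∈ M₃(R)` with `det H₂ = det H₁ · tσt` are congruent (`Hᵢ ≅ diag(1) ⊥ Pᵢ`, `det P₂ = det P₁ · N(f)`, ★ rank-2 `exists_formCongr_eq_of_det_eq_mul_norm`,
block-embedded) — unimodular hermitian lattices of odd rank `3` over a tamely ramified `𝒪_w` are CLASSIFIED BY THE DETERMINANT CLASS `det ∈ R^{×σ} ∕ N(R^×)`.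
(§4) **`exists_formCongr_smul_antidiagonal_eq_three`**: `H = ᵗσ(A) (a·J₀) A` with `a = −det H`, `J₀ = antidiag(1,1,1)` (`det(a J₀) = −a³ = det H · N(det H)`), and the
`•`-outside spelling `H = a • ᵗσ(A) J₀ A` the fold binds.  VALUED-FIELD TWINS ALREADY ★ (another currency, another route): ★ p846325 `exists_glInt_eq_smul_formCongr_antidiagonal_of_isotropic`
+ ★ p846330 (residual isotropy, Chevalley–Warning) ⇒ ★ p846344 `exists_glInt_placeForm_eq_smul_formCongr_antidiagonal_of_neg` (F0P3a-p07), which is what the ramified fold consumes;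
what is new here is the INTEGRAL CLASSIFICATION §3 and the normal form §2 over an abstract local ring (ref5 (g3) R-216).
HONEST LABEL: HC_CM is proved only modulo the 2 remaining named inputs (hLiu418 24832, h413 24833) until rung 0 closes; nothing printed is asserted here.

## References
* [Jacobowitz1962] R. Jacobowitz, *Hermitian forms over local fields*, Amer. J. Math. 84 (1962), §8 (ramified non-dyadic: `ϖ^i`-modular lattices with `i` even are
  diagonalisable and classified by rank and discriminant), §4 (4.2)–(4.4) (the splitting step).
* [Omeara1963] O. T. O'Meara, *Introduction to Quadratic Forms* (1963), §92:1–92:2.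
-/

set_option autoImplicit false

open scoped Matrix
open Matrix

namespace Literature.NumberTheory.QuadraticForms.HermitianUnimodularRamified

open Literature.NumberTheory.Automorphic Literature.NumberTheory.Automorphic.UnitaryGroup

variable {R : Type*} [CommRing R] (σ : R →+* R)

/-! ## §1 `3 × 3` bookkeeping (any commutative ring) -/

section ThreeByThree

omit σ in
/-- `antidiag(1,1,1)` over `R`, as an explicit matrix. [cite: Omeara1963, §92:1] -/
theorem antidiagonal_three_over : (StdForm.antidiagonal 3).over R = !![(0 : R), 0, 1; 0, 1, 0; 1, 0, 0] := by
  have hr0 : Fin.rev (0 : Fin 3) = 2 := rfl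
  have hr1 : Fin.rev (1 : Fin 3) = 1 := rfl
  have hr2 : Fin.rev (2 : Fin 3) = 0 := rfl
  ext i j
  fin_cases i <;> fin_cases j <;> simp [StdForm.over, StdForm.antidiagonal_J_apply, hr0, hr1, hr2]

omit σ in
/-- `det (a • antidiag(1,1,1)) = −a³`. [cite: Omeara1963, §92:1] -/
theorem det_smul_antidiagonal_three (a : R) : (a • (StdForm.antidiagonal 3).over R).det = -a ^ 3 := by
  rw [antidiagonal_three_over, Matrix.smul_of]
  simp [Matrix.det_fin_three]
  ring

/-- The matrix of `GeneralLinearGroup.mk'' A h` is `A` (`3 × 3`). [cite: Omeara1963, §92:1] -/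
theorem coe_mk''_three (A : Matrix (Fin 3) (Fin 3) R) (h : IsUnit A.det) :
    ((Matrix.GeneralLinearGroup.mk'' A h : GL (Fin 3) R) : Matrix (Fin 3) (Fin 3) R) = A := rfl

/-- Congruence by the swap `0 ↔ 1`. [cite: Omeara1963, §92:1] -/
theorem formCongr_swap01_three (M : Matrix (Fin 3) (Fin 3) R) (hS : IsUnit (!![(0 : R), 1, 0; 1, 0, 0; 0, 0, 1]).det) :
    formCongr σ (Matrix.GeneralLinearGroup.mk'' _ hS) M = !![M 1 1, M 1 0, M 1 2; M 0 1, M 0 0, M 0 2; M 2 1, M 2 0, M 2 2] := by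
  ext i j
  fin_cases i <;> fin_cases j <;>
    simp [formCongr, Matrix.mul_apply, Fin.sum_univ_three, Matrix.transpose_apply, Matrix.map_apply]

/-- Congruence by the swap `0 ↔ 2`. [cite: Omeara1963, §92:1] -/
theorem formCongr_swap02_three (M : Matrix (Fin 3) (Fin 3) R) (hS : IsUnit (!![(0 : R), 0, 1; 0, 1, 0; 1, 0, 0]).det) :
    formCongr σ (Matrix.GeneralLinearGroup.mk'' _ hS) M = !![M 2 2, M 2 1, M 2 0; M 1 2, M 1 1, M 1 0; M 0 2, M 0 1, M 0 0] := by
  ext i j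
  fin_cases i <;> fin_cases j <;>
    simp [formCongr, Matrix.mul_apply, Fin.sum_univ_three, Matrix.transpose_apply, Matrix.map_apply]

/-- **The Schur split in rank 3**: for `H = !![u, b, c; σb, p, q; σc, r, s]` with `u` invertible (`u·u⁻ = 1`, `σ(u⁻)·u = 1`), the transvection
`e₁ ↦ e₁ − u⁻ b e₀`, `e₂ ↦ e₂ − u⁻ c e₀` makes `H` block diagonal `diag(u) ⊥ P`. [cite: Jacobowitz1962, §4 (4.2)–(4.4)] [cite: Omeara1963, §92:1] -/
theorem formCongr_schur_three {u b c b' c' p q r s ui : R} (hui : u * ui = 1) (hσui : σ ui * u = 1) (hb' : b' = σ b) (hc' : c' = σ c)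
    (hT : IsUnit (!![(1 : R), -(ui * b), -(ui * c); 0, 1, 0; 0, 0, 1]).det) :
    formCongr σ (Matrix.GeneralLinearGroup.mk'' _ hT) !![u, b, c; b', p, q; c', r, s] =
      !![u, 0, 0; 0, p - σ (ui * b) * b, q - σ (ui * b) * c; 0, r - σ (ui * c) * b, s - σ (ui * c) * c] := by
  ext i j
  fin_cases i <;> fin_cases j <;>
    simp [formCongr, Matrix.mul_apply, Fin.sum_univ_three, Matrix.transpose_apply, Matrix.map_apply, hb', hc']
  · linear_combination (-b) * hui
  · linear_combination (-c) * hui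
  · linear_combination (-(σ b)) * hσui
  · linear_combination (σ b * ui * b) * hσui
  · linear_combination (σ b * ui * c) * hσui
  · linear_combination (-(σ c)) * hσui
  · linear_combination (σ c * ui * b) * hσui
  · linear_combination (σ c * ui * c) * hσui

/-- The determinant of the block embedding `diag(1, T′)`. [cite: Omeara1963, §92:1] -/
theorem det_blockOne_three (T' : Matrix (Fin 2) (Fin 2) R) :
    (!![(1 : R), 0, 0; 0, T' 0 0, T' 0 1; 0, T' 1 0, T' 1 1]).det = T'.det := by
  rw [Matrix.det_fin_three, Matrix.det_fin_two]
  simp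

/-- **The block embedding** `diag(1, T′)` acts on a block-diagonal `diag(a) ⊥ P` through `T′` on `P`. [cite: Omeara1963, §92:1] -/
theorem formCongr_blockOne_three (a : R) (T' : GL (Fin 2) R) (P : Matrix (Fin 2) (Fin 2) R)
    (hT : IsUnit (!![(1 : R), 0, 0; 0, (T' : Matrix (Fin 2) (Fin 2) R) 0 0, (T' : Matrix (Fin 2) (Fin 2) R) 0 1;
      0, (T' : Matrix (Fin 2) (Fin 2) R) 1 0, (T' : Matrix (Fin 2) (Fin 2) R) 1 1]).det) :
    formCongr σ (Matrix.GeneralLinearGroup.mk'' _ hT) !![a, 0, 0; 0, P 0 0, P 0 1; 0, P 1 0, P 1 1] =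
      !![a, 0, 0; 0, formCongr σ T' P 0 0, formCongr σ T' P 0 1; 0, formCongr σ T' P 1 0, formCongr σ T' P 1 1] := by
  ext i j
  fin_cases i <;> fin_cases j <;>
    simp [formCongr, Matrix.mul_apply, Fin.sum_univ_three, Fin.sum_univ_two, Matrix.transpose_apply, Matrix.map_apply]

/-- A `3 × 3` diagonal matrix with `σ`-fixed entries is `σ`-hermitian. [cite: Jacobowitz1962, §4] -/
theorem diagonal_hermitian_three {a u d : R} (ha : σ a = a) (hu : σ u = u) (hd : σ d = d) :
    ((Matrix.diagonal ![a, u, d]).map σ)ᵀ = Matrix.diagonal ![a, u, d] := by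
  ext i j
  fin_cases i <;> fin_cases j <;> simp [Matrix.diagonal, ha, hu, hd]

/-- The determinant of a `σ`-hermitian matrix is `σ`-fixed. [cite: Jacobowitz1962, §4] -/
theorem map_det_of_hermitian {ι : Type*} [Fintype ι] [DecidableEq ι] {H : Matrix ι ι R} (hH : (H.map σ)ᵀ = H) : σ H.det = H.det := by
  conv_rhs => rw [← hH]
  rw [Matrix.det_transpose, ← RingHom.mapMatrix_apply, ← RingHom.map_det]

end ThreeByThree

/-! ## §2 Diagonalisation to `diag(1, u, δ)` -/

section Diagonal

variable [IsLocalRing R] (hσ : ∀ x, σ (σ x) = x) (h2 : IsUnit (2 : R)) (hres : ∀ r : R, σ r - r ∈ IsLocalRing.maximalIdeal R)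
  (hnorm₁ : ∀ u : R, σ u = u → u - 1 ∈ IsLocalRing.maximalIdeal R → ∃ t : R, t * σ t = u)

include hσ h2 in
/-- **A unit pivot at position `0`, split off**: every unimodular `σ`-hermitian `H ∈ M₃(R)` is congruent to a block-diagonal `diag(u) ⊥ P` with `u` a `σ`-fixed unit
and `P ∈ M₂(R)` unimodular `σ`-hermitian (★ `HermitianUnimodular.exists_isUnit_formCongr_diag`, a swap, the Schur split). [cite: Jacobowitz1962, §4 (4.2)–(4.4)] -/
theorem exists_formCongr_eq_blockOne_three (H : Matrix (Fin 3) (Fin 3) R) (hH : (H.map σ)ᵀ = H) (hdet : IsUnit H.det) :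
    ∃ (T : GL (Fin 3) R) (u : R) (P : Matrix (Fin 2) (Fin 2) R), σ u = u ∧ IsUnit u ∧ (P.map σ)ᵀ = P ∧ IsUnit P.det ∧
      formCongr σ T H = !![u, 0, 0; 0, P 0 0, P 0 1; 0, P 1 0, P 1 1] := by
  -- a unit pivot, moved to position `0`
  obtain ⟨E₀, p, hp⟩ := HermitianUnimodular.exists_isUnit_formCongr_diag σ (exists_add_map_eq_one σ h2) H hH hdet
  have hswap : ∃ E : GL (Fin 3) R, IsUnit (formCongr σ E H 0 0) := by
    fin_cases p
    · exact ⟨E₀, hp⟩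
    · have hSdet : IsUnit (!![(0 : R), 1, 0; 1, 0, 0; 0, 0, 1]).det := by simp [Matrix.det_fin_three]
      refine ⟨E₀ * Matrix.GeneralLinearGroup.mk'' _ hSdet, ?_⟩
      rw [formCongr_mul_eq_formCongr_formCongr, formCongr_swap01_three]
      simpa using hp
    · have hSdet : IsUnit (!![(0 : R), 0, 1; 0, 1, 0; 1, 0, 0]).det := by simp [Matrix.det_fin_three]
      refine ⟨E₀ * Matrix.GeneralLinearGroup.mk'' _ hSdet, ?_⟩
      rw [formCongr_mul_eq_formCongr_formCongr, formCongr_swap02_three]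
      simpa using hp
  obtain ⟨E, hE⟩ := hswap
  set H₁ := formCongr σ E H with hH₁def
  have hH₁ : (H₁.map σ)ᵀ = H₁ := formCongr_hermitian σ hσ E hH
  have hent : ∀ i j, σ (H₁ j i) = H₁ i j := fun i j => by
    have := congr_fun (congr_fun hH₁ i) j
    simpa [Matrix.transpose_apply, Matrix.map_apply] using this
  -- names for the entries
  obtain ⟨uu, huu⟩ := hE
  set u := H₁ 0 0 with hu
  set b := H₁ 0 1 with hb
  set c := H₁ 0 2 with hc
  set p₀ := H₁ 1 1 with hp₀
  set q := H₁ 1 2 with hq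
  set r := H₁ 2 1 with hr
  set s := H₁ 2 2 with hs
  have hσu : σ u = u := hent 0 0
  have hH₁e : H₁ = !![u, b, c; σ b, p₀, q; σ c, r, s] := by
    ext i j
    fin_cases i <;> fin_cases j <;> simp [hu, hb, hc, hp₀, hq, hr, hs, hent]
  -- the Schur split
  set ui : R := ((uu⁻¹ : Rˣ) : R) with hui'
  have hui : u * ui = 1 := by rw [hui', ← huu, Units.mul_inv]
  have hσui : σ ui * u = 1 := by
    have h1 : σ ui * σ u = 1 := by rw [← map_mul, mul_comm, hui, map_one]
    rwa [hσu] at h1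
  have hTdet : IsUnit (!![(1 : R), -(ui * b), -(ui * c); 0, 1, 0; 0, 0, 1]).det := by simp [Matrix.det_fin_three]
  set P : Matrix (Fin 2) (Fin 2) R := !![p₀ - σ (ui * b) * b, q - σ (ui * b) * c; r - σ (ui * c) * b, s - σ (ui * c) * c] with hP
  have hsplit : formCongr σ (E * Matrix.GeneralLinearGroup.mk'' _ hTdet) H = !![u, 0, 0; 0, P 0 0, P 0 1; 0, P 1 0, P 1 1] := by
    rw [formCongr_mul_eq_formCongr_formCongr, ← hH₁def, hH₁e, formCongr_schur_three σ hui hσui rfl rfl hTdet, hP]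
    ext i j
    fin_cases i <;> fin_cases j <;> rfl
  -- `P` is hermitian and unimodular
  have hBh : ((!![u, 0, 0; 0, P 0 0, P 0 1; 0, P 1 0, P 1 1] : Matrix (Fin 3) (Fin 3) R).map σ)ᵀ = !![u, 0, 0; 0, P 0 0, P 0 1; 0, P 1 0, P 1 1] := by
    rw [← hsplit]; exact formCongr_hermitian σ hσ _ hH
  have hPh : (P.map σ)ᵀ = P := by
    ext i j
    fin_cases i <;> fin_cases j
    · simpa [Matrix.transpose_apply, Matrix.map_apply] using congr_fun (congr_fun hBh 1) 1
    · simpa [Matrix.transpose_apply, Matrix.map_apply] using congr_fun (congr_fun hBh 1) 2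
    · simpa [Matrix.transpose_apply, Matrix.map_apply] using congr_fun (congr_fun hBh 2) 1
    · simpa [Matrix.transpose_apply, Matrix.map_apply] using congr_fun (congr_fun hBh 2) 2
  have hBdet : IsUnit (!![u, 0, 0; 0, P 0 0, P 0 1; 0, P 1 0, P 1 1] : Matrix (Fin 3) (Fin 3) R).det := by
    rw [← hsplit, det_formCongr]
    exact hdet.mul ((Matrix.isUnits_det_units _).mul ((Matrix.isUnits_det_units _).map σ))
  have hPdet : IsUnit P.det := by
    have hBd : (!![u, 0, 0; 0, P 0 0, P 0 1; 0, P 1 0, P 1 1] : Matrix (Fin 3) (Fin 3) R).det = u * P.det := by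
      rw [Matrix.det_fin_three, Matrix.det_fin_two]; simp; ring
    rw [hBd] at hBdet
    exact isUnit_of_mul_isUnit_right hBdet
  exact ⟨E * Matrix.GeneralLinearGroup.mk'' _ hTdet, u, P, hσu, ⟨uu, huu⟩, hPh, hPdet, hsplit⟩

variable [Finite (IsLocalRing.ResidueField R)]

include hσ h2 hres hnorm₁ in
/-- **`H ≅ diag(1, u, δ)`**: every unimodular `σ`-hermitian `H ∈ M₃(R)` is congruent to `diag(1, u, δ)` with `u, δ` `σ`-fixed units (split `H ≅ diag(u) ⊥ P`, ★ rank-2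
`exists_formCongr_eq_diagonal_one` on `P ≅ diag(1, δ)`, swap `0 ↔ 1`). [cite: Jacobowitz1962, §8] [cite: Omeara1963, §92:2] -/
theorem exists_formCongr_eq_diagonal_one_three (H : Matrix (Fin 3) (Fin 3) R) (hH : (H.map σ)ᵀ = H) (hdet : IsUnit H.det) :
    ∃ (T : GL (Fin 3) R) (u δ : R), σ u = u ∧ σ δ = δ ∧ IsUnit u ∧ IsUnit δ ∧ formCongr σ T H = Matrix.diagonal ![1, u, δ] := by
  obtain ⟨T₁, u, P, hσu, hu, hPh, hPdet, h₁⟩ := exists_formCongr_eq_blockOne_three σ hσ h2 H hH hdet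
  obtain ⟨T₂, δ, hσδ, hδ, h₂⟩ := exists_formCongr_eq_diagonal_one σ hσ h2 hres hnorm₁ P hPh hPdet
  -- embed `T₂` as `diag(1, T₂)`
  have hT₃ : IsUnit (!![(1 : R), 0, 0; 0, (T₂ : Matrix (Fin 2) (Fin 2) R) 0 0, (T₂ : Matrix (Fin 2) (Fin 2) R) 0 1;
      0, (T₂ : Matrix (Fin 2) (Fin 2) R) 1 0, (T₂ : Matrix (Fin 2) (Fin 2) R) 1 1]).det := by
    rw [det_blockOne_three]; exact Matrix.isUnits_det_units T₂
  have hS : IsUnit (!![(0 : R), 1, 0; 1, 0, 0; 0, 0, 1]).det := by simp [Matrix.det_fin_three]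
  refine ⟨T₁ * Matrix.GeneralLinearGroup.mk'' _ hT₃ * Matrix.GeneralLinearGroup.mk'' _ hS, u, δ, hσu, hσδ, hu, hδ, ?_⟩
  rw [formCongr_mul_eq_formCongr_formCongr, formCongr_mul_eq_formCongr_formCongr, h₁, formCongr_blockOne_three σ u T₂ P hT₃, h₂,
    formCongr_swap01_three]
  ext i j
  fin_cases i <;> fin_cases j <;> simp [Matrix.diagonal]

/-! ## §3 Classification by the determinant class -/

include hσ h2 hres hnorm₁ in
/-- **UNIMODULAR HERMITIAN LATTICES OF RANK 3 WITH THE SAME DETERMINANT CLASS ARE ISOMETRIC**: if `det H₂ = det H₁ · tσt` then `∃ T : GL₃(R), (σT)ᵀ H₁ T = H₂`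
(`Hᵢ ≅ diag(1) ⊥ diag(uᵢ, δᵢ)`; the planes have determinants in one norm class, so ★ `exists_formCongr_eq_of_det_eq_mul_norm` matches them; block-embed).
[cite: Jacobowitz1962, §8] [cite: Omeara1963, §92:2] -/
theorem exists_formCongr_eq_of_det_eq_mul_norm_three (H₁ H₂ : Matrix (Fin 3) (Fin 3) R)
    (hH₁ : (H₁.map σ)ᵀ = H₁) (hdet₁ : IsUnit H₁.det) (hH₂ : (H₂.map σ)ᵀ = H₂) (hdet₂ : IsUnit H₂.det)
    (t : R) (hdet : H₂.det = H₁.det * (t * σ t)) :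
    ∃ T : GL (Fin 3) R, formCongr σ T H₁ = H₂ := by
  obtain ⟨T₁, u₁, δ₁, hσu₁, hσδ₁, hu₁, hδ₁, h₁⟩ := exists_formCongr_eq_diagonal_one_three σ hσ h2 hres hnorm₁ H₁ hH₁ hdet₁
  obtain ⟨T₂, u₂, δ₂, hσu₂, hσδ₂, hu₂, hδ₂, h₂⟩ := exists_formCongr_eq_diagonal_one_three σ hσ h2 hres hnorm₁ H₂ hH₂ hdet₂
  -- determinants: `uᵢ δᵢ = det Hᵢ · N(det Tᵢ)`
  have hd₁ : u₁ * δ₁ = H₁.det * ((T₁ : Matrix (Fin 3) (Fin 3) R).det * σ (T₁ : Matrix (Fin 3) (Fin 3) R).det) := by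
    have := det_formCongr σ T₁ H₁
    rw [h₁, Matrix.det_diagonal, Fin.prod_univ_three] at this
    simpa using this
  have hd₂ : u₂ * δ₂ = H₂.det * ((T₂ : Matrix (Fin 3) (Fin 3) R).det * σ (T₂ : Matrix (Fin 3) (Fin 3) R).det) := by
    have := det_formCongr σ T₂ H₂
    rw [h₂, Matrix.det_diagonal, Fin.prod_univ_three] at this
    simpa using this
  obtain ⟨v₁, hv₁⟩ := Matrix.isUnits_det_units T₁
  set f : R := t * (T₂ : Matrix (Fin 3) (Fin 3) R).det * ((v₁⁻¹ : Rˣ) : R) with hfdef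
  have hv₁inv : ((v₁⁻¹ : Rˣ) : R) * (T₁ : Matrix (Fin 3) (Fin 3) R).det = 1 := by rw [← hv₁, Units.inv_mul]
  have hσv₁inv : σ ((v₁⁻¹ : Rˣ) : R) * σ (T₁ : Matrix (Fin 3) (Fin 3) R).det = 1 := by rw [← map_mul, hv₁inv, map_one]
  -- the two planes `diag(uᵢ, δᵢ)` have determinants in one norm class
  have hplane : (Matrix.diagonal ![u₂, δ₂]).det = (Matrix.diagonal ![u₁, δ₁]).det * (f * σ f) := by
    rw [Matrix.det_diagonal, Matrix.det_diagonal, Fin.prod_univ_two, Fin.prod_univ_two]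
    simp only [Matrix.cons_val_zero, Matrix.cons_val_one]
    rw [hd₂, hdet, hd₁, hfdef, map_mul, map_mul]
    linear_combination (H₁.det * (t * σ t) * ((T₂ : Matrix (Fin 3) (Fin 3) R).det * σ (T₂ : Matrix (Fin 3) (Fin 3) R).det)) *
      (-(σ ((v₁⁻¹ : Rˣ) : R) * σ (T₁ : Matrix (Fin 3) (Fin 3) R).det) * hv₁inv - hσv₁inv)
  have hD₁h : ((Matrix.diagonal ![u₁, δ₁]).map σ)ᵀ = Matrix.diagonal ![u₁, δ₁] := diagonal_hermitian σ hσu₁ hσδ₁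
  have hD₂h : ((Matrix.diagonal ![u₂, δ₂]).map σ)ᵀ = Matrix.diagonal ![u₂, δ₂] := diagonal_hermitian σ hσu₂ hσδ₂
  have hD₁det : IsUnit (Matrix.diagonal ![u₁, δ₁]).det := by
    rw [Matrix.det_diagonal, Fin.prod_univ_two]; simpa using hu₁.mul hδ₁
  have hD₂det : IsUnit (Matrix.diagonal ![u₂, δ₂]).det := by
    rw [Matrix.det_diagonal, Fin.prod_univ_two]; simpa using hu₂.mul hδ₂
  obtain ⟨T', hT'⟩ := exists_formCongr_eq_of_det_eq_mul_norm σ hσ h2 hres hnorm₁ _ _ hD₁h hD₁det hD₂h hD₂det f hplane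
  -- block-embed `T′`
  have hT₃ : IsUnit (!![(1 : R), 0, 0; 0, (T' : Matrix (Fin 2) (Fin 2) R) 0 0, (T' : Matrix (Fin 2) (Fin 2) R) 0 1;
      0, (T' : Matrix (Fin 2) (Fin 2) R) 1 0, (T' : Matrix (Fin 2) (Fin 2) R) 1 1]).det := by
    rw [det_blockOne_three]; exact Matrix.isUnits_det_units T'
  have hdiag₁ : Matrix.diagonal ![(1 : R), u₁, δ₁] =
      !![1, 0, 0; 0, (Matrix.diagonal ![u₁, δ₁]) 0 0, (Matrix.diagonal ![u₁, δ₁]) 0 1; 0, (Matrix.diagonal ![u₁, δ₁]) 1 0, (Matrix.diagonal ![u₁, δ₁]) 1 1] := by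
    ext i j; fin_cases i <;> fin_cases j <;> simp [Matrix.diagonal]
  have hdiag₂ : (!![1, 0, 0; 0, (Matrix.diagonal ![u₂, δ₂]) 0 0, (Matrix.diagonal ![u₂, δ₂]) 0 1; 0, (Matrix.diagonal ![u₂, δ₂]) 1 0, (Matrix.diagonal ![u₂, δ₂]) 1 1]
      : Matrix (Fin 3) (Fin 3) R) = Matrix.diagonal ![(1 : R), u₂, δ₂] := by
    ext i j; fin_cases i <;> fin_cases j <;> simp [Matrix.diagonal]
  refine ⟨T₁ * Matrix.GeneralLinearGroup.mk'' _ hT₃ * T₂⁻¹, ?_⟩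
  rw [formCongr_mul_eq_formCongr_formCongr, formCongr_mul_eq_formCongr_formCongr, h₁, hdiag₁, formCongr_blockOne_three σ 1 T' _ hT₃, hT', hdiag₂, ← h₂,
    formCongr_inv_formCongr]

/-! ## §4 The antidiagonal normal form `H = ᵗσ(A) (−det H · J₀) A` -/

include hσ h2 hres hnorm₁ in
/-- **EVERY UNIMODULAR HERMITIAN `H ∈ M₃(R)` IS CONGRUENT TO `a·J₀`, `a = −det H`, `J₀ = antidiag(1,1,1)`** (`det (a J₀) = −a³ = (det H)³ = det H · N(det H)`, and `det H` is a
`σ`-fixed unit). This supplies the INTEGRAL antidiagonal frame of a hyperspecial unitary group at a tamely ramified place. [cite: Jacobowitz1962, §8] [cite: Omeara1963, §92:2] -/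
theorem exists_formCongr_smul_antidiagonal_eq_three (H : Matrix (Fin 3) (Fin 3) R) (hH : (H.map σ)ᵀ = H) (hdet : IsUnit H.det) :
    ∃ A : GL (Fin 3) R, formCongr σ A ((-H.det) • (StdForm.antidiagonal 3).over R) = H := by
  have hσd : σ H.det = H.det := map_det_of_hermitian σ hH
  obtain ⟨d, hd⟩ := hdet
  -- `a • J₀` is hermitian and unimodular
  have hJh : (((-H.det) • (StdForm.antidiagonal 3).over R).map σ)ᵀ = (-H.det) • (StdForm.antidiagonal 3).over R := by
    rw [antidiagonal_three_over]
    ext i j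
    fin_cases i <;> fin_cases j <;> simp [hσd]
  have hJdet : IsUnit ((-H.det) • (StdForm.antidiagonal 3).over R).det := by
    rw [det_smul_antidiagonal_three, neg_pow, ← hd]
    simp
  -- the determinant class: `det H = det(a J₀) · N(d⁻¹)`
  have hdinv : H.det * ((d⁻¹ : Rˣ) : R) = 1 := by rw [← hd, Units.mul_inv]
  have hσdinv : σ ((d⁻¹ : Rˣ) : R) = ((d⁻¹ : Rˣ) : R) := by
    -- `σ(d⁻¹)` is also an inverse of `d = σ d`
    have h1 : H.det * σ ((d⁻¹ : Rˣ) : R) = 1 := by rw [← hσd, ← map_mul, hdinv, map_one]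
    calc σ ((d⁻¹ : Rˣ) : R) = ((d⁻¹ : Rˣ) : R) * H.det * σ ((d⁻¹ : Rˣ) : R) := by rw [mul_comm ((d⁻¹ : Rˣ) : R), hdinv, one_mul]
      _ = ((d⁻¹ : Rˣ) : R) := by rw [mul_assoc, h1, mul_one]
  have hclass : H.det = ((-H.det) • (StdForm.antidiagonal 3).over R).det * (((d⁻¹ : Rˣ) : R) * σ ((d⁻¹ : Rˣ) : R)) := by
    rw [det_smul_antidiagonal_three, hσdinv]
    linear_combination (-(H.det) * (H.det * ((d⁻¹ : Rˣ) : R) + 1)) * hdinv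
  exact exists_formCongr_eq_of_det_eq_mul_norm_three σ hσ h2 hres hnorm₁ _ H hJh hJdet hH ⟨d, hd⟩ _ hclass

include hσ h2 hres hnorm₁ in
/-- The same frame in the `•`-outside spelling the ramified fold binds: `H = (−det H) • ᵗσ(A) J₀ A`. [cite: Jacobowitz1962, §8] -/
theorem exists_eq_smul_formCongr_antidiagonal_three (H : Matrix (Fin 3) (Fin 3) R) (hH : (H.map σ)ᵀ = H) (hdet : IsUnit H.det) :
    ∃ A : GL (Fin 3) R, H = (-H.det) • formCongr σ A ((StdForm.antidiagonal 3).over R) := by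
  obtain ⟨A, hA⟩ := exists_formCongr_smul_antidiagonal_eq_three σ hσ h2 hres hnorm₁ H hH hdet
  refine ⟨A, ?_⟩
  conv_lhs => rw [← hA]
  rw [formCongr, formCongr, Matrix.mul_smul, Matrix.smul_mul]

end Diagonal

end Literature.NumberTheory.QuadraticForms.HermitianUnimodularRamified
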